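import Summits.ResolutionOfSingularities.ResolutionOfSingularities.Theorems.PurelyInseparableDim4E2OfCJSModel
import Summits.ResolutionOfSingularities.ResolutionOfSingularities.Theorems.PurelyInseparableDim4E2OfCJSSetting
import HarnessLib

/-!
# F4-I(3,3) from CJS — row (M) split, part (M-b): the LOCALISATION row (OURS, open) and the composition
# «(M-a) global model ∧ (M-b) localisation ⇒ (M) `ModelRow`»; the assembly with (X) discharged
# (cell `res-dim4-pi`, WORD #52 (c) / #57; sub-row (M) of the E2 transfer row)

[OURS · counted 0 · AI work weaker than expert review.]  Cell `res-dim4-pi` (D-0157 DOOR 2), seat `res-dim4-p-2`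
g2; K → res-dim4-p-9 g2.  NOTHING here proves `LocalizationRow`, `ModelRow`, `NoIsolatedTrap 3 3` or resolution of
singularities in dimension ≥ 4 / characteristic `p`.

Companion of `…E2OfCJSModel` ((M-a) `globalModel_of_coneTwoChain`, PROVED: the infinite tower of point
blow-ups of ambients with marked ideals `(z³ + (c i).F)·𝒪` on open-immersion charts) and `…E2OfCJSSetting`
((X) `settingRow`, PROVED).  Here: the remaining half of row (M) as ONE OURS row `LocalizationRow` (global
tower ⇒ the LOCAL schemes `Spec 𝒪_{X_i,x_i}` of the hypersurfaces, their point blow-ups by flat base change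
along `fromSpecStalk`, the local-scheme links, and the PRESENTATIONS `PresentedBy K (c i).F` from the charts;
its one geometric atom (M-c) «strict transform = blow-up of the hypersurface» is named in the docstring), the
composition `modelRow_of_localizationRow : LocalizationRow → ModelRow`, and the assembly
`noIsolatedTrap_three_three_of_CJS_rows'` — F4-I(3,3) ⟸ CJS Thm 6.40 ∧ (M-b) ∧ (N) ∧ (E) ∧ (I).
bears_on: LADDER-RESOLUTION:D157-DOOR2 (res-dim4-pi · F4-I(3,3) · CJS dictionary · row M-b).  Supports
stmt-ResolutionOfSingularities-16155 (helper).
-/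

set_option linter.dupNamespace false -- mandated namespace of this single-conjunct summit

noncomputable section

open CategoryTheory AlgebraicGeometry TopologicalSpace
open Literature.AlgebraicGeometry.Resolution
open Literature.AlgebraicGeometry.Resolution.Hauser2010
open Literature.AlgebraicGeometry.Resolution.AffinePointBlowup (P A ξ)
open Literature.AlgebraicGeometry.CossartJannsenSaito2020
open Scheme.IdealSheafData

namespace Summit.ResolutionOfSingularities.ResolutionOfSingularities.Theorems.PIDim4

namespace E2OfCJS

open RidgeBudget (ebar)

/-! ## (M-b) The localisation row and the composition (M-a) ∧ (M-b) ⇒ (M) -/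

/-- [OURS · row (M-b) LOCALISATION · open] **A GLOBAL MODEL LOCALISES.** Over an algebraically closed field of
characteristic `3`, given an E2-violating frame chain `c` AND a global model of it (the data produced by
`globalModel_of_coneTwoChain`, p-(M-a): ambients `Z i`, marked ideals `M i` of multiplicity `3`, closed points
`x i`, open-immersion charts `φ i` with `(M i).ideal.comap (φ i) = hypSheaf 3 (c i).F`, blowing ups
`π i : Z (i+1) ⟶ Z i` of `x i` with `M (i+1) = (M i).transform (π i) 𝓘_{x i}` and `π i (x (i+1)) = x i`), the
LOCAL data of `ModelRow` exist: with `X i = V((M i).ideal) ⊂ Z i` the hypersurface, `S i := Spec 𝒪_{X_i, x_i}`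
(local), `B i :=` the base change of `Bl_{x_i} X_i ⟶ X_i` along the flat `Spec 𝒪_{X_i,x_i} ⟶ X_i`
(W4.2: `IsBlowup.pullback_snd_of_flat`, `flat_fromSpecStalk`), `b i` the point of `B i` over `x_{i+1}`
(`mem_range_pullback_fst_fromSpecStalk_of_eq`), `IsLocalSchemeAt (S (i+1)) (pt (i+1)) (B i) (b i)`
(`isIso_stalkMap_pullback_fst_fromSpecStalk`), and the PRESENTATIONS `𝒪_{X_i,x_i} ≅ HypStalk K (c i).F` from
the charts (an open immersion induces `𝒪_{Z_i,x_i} ≅ 𝒪_{𝔸⁵,0}` carrying the stalk of `(M i).ideal` to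
`(z³ + (c i).F)_0`).  Its one geometric atom (M-c): «the closed subscheme of `Bl_{x_i} Z_i` cut by the
controlled transform of `(M i).ideal` with control `3` (= the STRICT transform, the order at `x_i` being
exactly `3`) IS the blow-up `Bl_{x_i} X_i` of the hypersurface».  NOT proved here. (OURS row — parameterless
`Prop`, deliberately untagged; not asserted.) -/
def LocalizationRow : Prop :=
  ∀ (K : Type) [Field K] [CharP K 3] [IsAlgClosed K] [DecidableEq K] (c : ℕ → State K),
    (∀ k, IsIsolated 3 (c k).F ∧ Step0 3 (c k) (c (k + 1)) ∧ ordZero (c k).F = (3 : ℕ∞) ∧ ebar (c k).F = 2) →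
    ∀ (Z : ℕ → Scheme.{0}) (_ : ∀ i, IsLocallyNoetherian (Z i)) (_ : ∀ i, JacobsonSpace ↥(Z i))
      (M : ∀ i, MarkedIdeal (Z i)) (x : ∀ i, ↥(Z i)) (hx : ∀ i, IsClosed ({x i} : Set (Z i)))
      (φ : ∀ i, P 4 K ⟶ Z i) (_ : ∀ i, IsOpenImmersion (φ i)) (π : ∀ i, Z (i + 1) ⟶ Z i),
      (∀ i, (M i).mult = 3 ∧ (φ i) (ξ 4 K) = x i ∧ (M i).ideal.comap (φ i) = hypSheaf 3 (c i).F ∧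
        IsBlowup (π i) (vanishingIdeal ⟨{x i}, hx i⟩) ∧
        M (i + 1) = (M i).transform (π i) (vanishingIdeal ⟨{x i}, hx i⟩) ∧ (π i) (x (i + 1)) = x i) →
    ∃ (S B : ℕ → Scheme.{0}) (_ : ∀ i, IsLocallyNoetherian (S i)) (_ : ∀ i, IsLocallyNoetherian (B i))
      (π' : ∀ i, B i ⟶ S i) (pt : ∀ i, ↥(S i)) (b : ∀ i, ↥(B i)) (hcl : ∀ i, IsClosed ({pt i} : Set (S i))),
      (∀ i, IsBlowup (π' i) (vanishingIdeal ⟨{pt i}, hcl i⟩)) ∧ (∀ i, (π' i).base (b i) = pt i) ∧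
      (∀ i, IsClosed ({b i} : Set (B i))) ∧ (∀ i, IsLocalSchemeAt (S (i + 1)) (pt (i + 1)) (B i) (b i)) ∧
      (∀ i, IsLocalAt (S i) (pt i)) ∧
      (∀ i, PresentedBy K (c i).F (S i) (pt i)) ∧ (∀ i, PresentedBy K (c (i + 1)).F (B i) (b i))

/-- **(M-a) ∧ (M-b) ⇒ (M)**: the global model (`globalModel_of_coneTwoChain`, PROVED) and the localisation row
give `ModelRow`. [OURS · glue] [folklore] -/
theorem modelRow_of_localizationRow (h : LocalizationRow) : ModelRow := by
  intro K _ _ _ _ c hc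
  obtain ⟨Z, hZ, hJ, M, x, hx, φ, hφ, π, hall⟩ := globalModel_of_coneTwoChain K c hc
  exact h K c hc Z hZ hJ M x hx φ hφ π hall

/-- **F4-I(3,3) from CJS Thm. 6.40 with (M-a) and (X) discharged**: the remaining OURS rows are the
localisation (M-b), «near» (N), the directrix (E) and the isolation (I). [OURS · conditional assembly]
[cite: CossartJannsenSaito2020, Thm. 6.40] -/
theorem noIsolatedTrap_three_three_of_CJS_rows' (hK640 : KeyTheorem640_char_localized_isolated.{0})
    (hMb : LocalizationRow) (hN : NearRow) (hE : DirectrixRow) (hI : IsolationRow) : NoIsolatedTrap 3 3 :=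
  noIsolatedTrap_three_three_of_CJS_rows hK640 (modelRow_of_localizationRow hMb) hN hE hI settingRow

end E2OfCJS

end Summit.ResolutionOfSingularities.ResolutionOfSingularities.Theorems.PIDim4

end
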